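import Summits.FinalStateConjecture.FinalStateConjecture.Theorems.StarvedNecksGapDecaySufficesStubAnchoredLocationV2
import Literature.Geometry.Lorentzian.MinkowskiSimplexFit

/-!
# Route StarvedNecks — crux `GapDecaySuffices` (stmt-FinalStateConjecture-18060), line `Sketch`: brick `stub_oneSidedIntervalComparison`

`stub_oneSidedIntervalComparison : AnchoredV2.OneSidedIntervalComparison` — the ONE-SIDED INTERVAL
COMPARISON for an exact isometry `k` between `η + h₁` (on an open convex coordinate region `D ⊆ E4`)
and `η + h₂` (on its image), with `‖h₁‖, ‖h₂ ∘ k‖ ≤ ε` and an a-priori operator bound `‖Dk‖ ≤ Γ`: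
with `C = 4(1 + Γ²)` and `ε ≤ ε₀ = 1/(2C)`, the `k`-images of uniformly timelike pairs `P, Q ∈ D`
(`η(Q − P, Q − P) ≤ −‖Q − P‖²/4`) satisfy `(1 − Cε)(−η(Q − P, Q − P)) ≤ −η(kQ − kP, kQ − kP)`.

PROOF (elementary, no manifolds).
1. Pointwise: for `u = Q − P` and `v = Dk_x u` the isometry identity gives
   `η(v, v) = η(u, u) + h₁(u, u) − h₂(v, v) ≤ η(u, u) + ε(1 + Γ²)‖u‖² ≤ (1 − Cε) η(u, u)`, so
   `−η(v, v) ≥ μ := (1 − Cε)(−η(u, u)) > 0` (`P ≠ Q`).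
2. The curve `γ s = k(P + s u)` (`s ∈ [0, 1]`, segment in `D` by convexity, `D` open) has derivative
   `v s = Dk_{P + su} u`; the time components `(v s)⁰ ≠ 0` have CONSTANT SIGN by Darboux
   (`hasDerivWithinAt_forall_lt_or_forall_gt_of_forall_ne`); by the symmetry `γ ↦ −γ` WLOG positive.
3. Support functions: for every future causal `T`, `s ↦ −η(T, γ s)` has derivative
   `−η(T, v s) ≥ √(−η(T, T)) √μ` (REVERSE CAUCHY–SCHWARZ in one time cone), hence
   `−η(T, γ 1 − γ 0) ≥ √(−η(T, T)) √μ` (monotonicity from a derivative lower bound).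
4. For `w = γ 1 − γ 0 = kQ − kP`: `T = ∂₀` gives `w⁰ ≥ √μ > 0`; if `w` is future timelike, `T = w`
   gives `−η(w, w) ≥ μ`; otherwise `T_t = ((t² + 1)|w̲|, (t² − 1) w̲)` gives `t√μ ≤ w⁰` for all
   `t ≥ 1`, absurd.
No definitions, no named facts, no `sorry`.
References: O'Neill 1983, Ch. 5 (reverse Cauchy–Schwarz and reverse triangle inequality in a time
cone); the rest is calculus (Mathlib).
-/

noncomputable section

open Set Literature.Geometry.Lorentzian
open Literature.Geometry.Lorentzian.MinkowskiSimplex (bilin_eq)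

namespace Summit.FinalStateConjecture.FinalStateConjecture.Theorems.GapDecaySuffices.Location.IntervalComparison

-- the summit-side namespace `Summit.FinalStateConjecture.FinalStateConjecture.…` of this
-- single-problem summit (CONVENTIONS §1) repeats a component by design:
set_option linter.dupNamespace false

/-! ## Coordinates -/

/-- `η(v, v) = −(v⁰)² + |v̲|²` in coordinates. [folklore] -/
private theorem bilin_self (v : E4) :
    Minkowski.bilin v v = -(v 0 ^ 2) + (v 1 ^ 2 + v 2 ^ 2 + v 3 ^ 2) := by
  rw [bilin_eq]; ring

/-- `η(−a, −b) = η(a, b)`. [folklore] -/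
private theorem bilin_neg_neg (a b : E4) : Minkowski.bilin (-a) (-b) = Minkowski.bilin a b := by
  simp only [map_neg, neg_apply, neg_neg]

/-! ## Reverse Cauchy–Schwarz in the future cone -/

/-- **Reverse Cauchy–Schwarz inequality** (O'Neill 1983, Ch. 5, Prop. 5.30, coordinate form): for two
future causal vectors `T, v` (`T⁰, v⁰ > 0`, `η(T, T) ≤ 0`, `η(v, v) ≤ 0`) one has
`√(−η(T, T)) · √(−η(v, v)) ≤ −η(T, v)`. [folklore] -/
private theorem reverse_cs (T v : E4) (hT0 : 0 < T 0) (hT : Minkowski.bilin T T ≤ 0)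
    (hv0 : 0 < v 0) (hv : Minkowski.bilin v v ≤ 0) :
    √(-Minkowski.bilin T T) * √(-Minkowski.bilin v v) ≤ -Minkowski.bilin T v := by
  obtain ⟨b, hb0, hb⟩ : ∃ b : ℝ, 0 ≤ b ∧ b ^ 2 = T 1 ^ 2 + T 2 ^ 2 + T 3 ^ 2 :=
    ⟨√(T 1 ^ 2 + T 2 ^ 2 + T 3 ^ 2), Real.sqrt_nonneg _, Real.sq_sqrt (by positivity)⟩
  obtain ⟨d, hd0, hd⟩ : ∃ d : ℝ, 0 ≤ d ∧ d ^ 2 = v 1 ^ 2 + v 2 ^ 2 + v 3 ^ 2 :=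
    ⟨√(v 1 ^ 2 + v 2 ^ 2 + v 3 ^ 2), Real.sqrt_nonneg _, Real.sq_sqrt (by positivity)⟩
  have hcs : (T 1 * v 1 + T 2 * v 2 + T 3 * v 3) ^ 2 ≤ (b * d) ^ 2 := by
    rw [mul_pow, hb, hd]
    nlinarith [sq_nonneg (T 1 * v 2 - T 2 * v 1), sq_nonneg (T 1 * v 3 - T 3 * v 1),
      sq_nonneg (T 2 * v 3 - T 3 * v 2)]
  have hp : T 1 * v 1 + T 2 * v 2 + T 3 * v 3 ≤ b * d := le_of_sq_le_sq hcs (mul_nonneg hb0 hd0)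
  rw [bilin_self] at hT hv
  have hba : b ≤ T 0 := le_of_sq_le_sq (by linarith) hT0.le
  have hdc : d ≤ v 0 := le_of_sq_le_sq (by linarith) hv0.le
  rw [bilin_self, bilin_self, bilin_eq, ← hb, ← hd, ← Real.sqrt_mul (by nlinarith)]
  calc √(-(-(T 0 ^ 2) + b ^ 2) * -(-(v 0 ^ 2) + d ^ 2)) ≤ √((T 0 * v 0 - b * d) ^ 2) :=
        Real.sqrt_le_sqrt (by nlinarith [sq_nonneg (T 0 * d - b * v 0)])
    _ = T 0 * v 0 - b * d := Real.sqrt_sq (by nlinarith)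
    _ ≤ _ := by linarith

/-! ## Support functions along a differentiable curve with future timelike velocities -/

/-- Along a curve `γ : [0, 1] → E4` with derivative `v s`, `(v s)⁰ > 0` and `−η(v s, v s) ≥ μ ≥ 0`,
every future causal `T` has `√(−η(T, T)) √μ ≤ −η(T, γ 1 − γ 0)` (reverse Cauchy–Schwarz for the
derivative of the support function `s ↦ −η(T, γ s)`, then monotonicity from the derivative lower
bound, `Convex.mul_sub_le_image_sub_of_le_deriv`). [folklore] -/
private theorem support_bound {γ v : ℝ → E4} {μ : ℝ} (hμ : 0 ≤ μ)
    (hγ : ∀ s ∈ Icc (0 : ℝ) 1, HasDerivAt γ (v s) s)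
    (hv0 : ∀ s ∈ Icc (0 : ℝ) 1, 0 < v s 0)
    (hvμ : ∀ s ∈ Icc (0 : ℝ) 1, μ ≤ -Minkowski.bilin (v s) (v s))
    (T : E4) (hT0 : 0 < T 0) (hT : Minkowski.bilin T T ≤ 0) :
    √(-Minkowski.bilin T T) * √μ ≤ -Minkowski.bilin T (γ 1 - γ 0) := by
  have hφd : ∀ s ∈ Icc (0 : ℝ) 1,
      HasDerivAt (fun r ↦ -Minkowski.bilin T (γ r)) (-Minkowski.bilin T (v s)) s := fun s hs ↦
    ((Minkowski.bilin T).hasFDerivAt.comp_hasDerivAt s (hγ s hs)).fun_neg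
  have hlow : ∀ s ∈ Icc (0 : ℝ) 1, √(-Minkowski.bilin T T) * √μ ≤ -Minkowski.bilin T (v s) := by
    intro s hs
    calc √(-Minkowski.bilin T T) * √μ
        ≤ √(-Minkowski.bilin T T) * √(-Minkowski.bilin (v s) (v s)) := by gcongr; exact hvμ s hs
      _ ≤ _ := reverse_cs T (v s) hT0 hT (hv0 s hs) (by linarith [hvμ s hs])
  have key := (convex_Icc (0 : ℝ) 1).mul_sub_le_image_sub_of_le_deriv
    (fun s hs ↦ (hφd s hs).continuousAt.continuousWithinAt)
    (fun s hs ↦ (hφd s (interior_subset hs)).differentiableAt.differentiableWithinAt)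
    (C := √(-Minkowski.bilin T T) * √μ)
    (fun s hs ↦ by rw [(hφd s (interior_subset hs)).deriv]; exact hlow s (interior_subset hs))
    0 (left_mem_Icc.2 zero_le_one) 1 (right_mem_Icc.2 zero_le_one) zero_le_one
  rw [sub_zero, mul_one] at key
  rw [map_sub]
  linarith

/-- If `−η(T, w) ≥ √(−η(T, T)) · m` for every future causal `T` and some `m > 0`, then
`−η(w, w) ≥ m²` (test with `T = ∂₀`, with `T = w`, and with the boosts
`T_t = ((t² + 1)|w̲|, (t² − 1)w̲)`, `t → ∞`). [folklore] -/
private theorem sq_le_of_support (w : E4) {m : ℝ} (hm : 0 < m)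
    (h : ∀ T : E4, 0 < T 0 → Minkowski.bilin T T ≤ 0 →
      √(-Minkowski.bilin T T) * m ≤ -Minkowski.bilin T w) :
    m ^ 2 ≤ -Minkowski.bilin w w := by
  -- the time component: test with `T = ∂₀`
  have h0 : m ≤ w 0 := by
    have h' := h (E4.basisVector 0) (by simp) (by rw [Minkowski.bilin_basisVector_zero]; norm_num)
    rw [Minkowski.bilin_basisVector_zero, Minkowski.bilin_basisVector_zero_left] at h'
    simpa using h'
  have hw0 : 0 < w 0 := hm.trans_le h0
  by_cases hσ : Minkowski.bilin w w < 0
  · -- `w` is future timelike: test with `T = w`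
    have h' := h w hw0 hσ.le
    have hN2 : √(-Minkowski.bilin w w) ^ 2 = -Minkowski.bilin w w := Real.sq_sqrt (by linarith)
    have hmN : m ≤ √(-Minkowski.bilin w w) := by
      by_contra! hlt
      nlinarith [Real.sqrt_nonneg (-Minkowski.bilin w w)]
    nlinarith [hmN, hm.le, hN2]
  · -- `w` is not timelike: test with the boosts `T_t`
    exfalso
    replace hσ := not_lt.1 hσ
    rw [bilin_self] at hσ
    obtain ⟨ρ, hρ0, hρ⟩ : ∃ ρ : ℝ, 0 ≤ ρ ∧ ρ ^ 2 = w 1 ^ 2 + w 2 ^ 2 + w 3 ^ 2 :=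
      ⟨√(w 1 ^ 2 + w 2 ^ 2 + w 3 ^ 2), Real.sqrt_nonneg _, Real.sq_sqrt (by positivity)⟩
    have hρw : w 0 ≤ ρ := le_of_sq_le_sq (by linarith) hρ0
    have hρpos : 0 < ρ := hw0.trans_le hρw
    obtain ⟨t, ht⟩ : ∃ t : ℝ, t = 2 * w 0 / m := ⟨_, rfl⟩
    have htm : t * m = 2 * w 0 := by rw [ht]; field_simp
    have ht1 : 1 ≤ t := by
      rw [ht, le_div_iff₀ hm]; linarith
    let T : E4 := WithLp.toLp 2 ![(t ^ 2 + 1) * ρ, (t ^ 2 - 1) * w 1, (t ^ 2 - 1) * w 2,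
      (t ^ 2 - 1) * w 3]
    have hT0 : T 0 = (t ^ 2 + 1) * ρ := by simp [T]
    have hT1 : T 1 = (t ^ 2 - 1) * w 1 := by simp [T]
    have hT2 : T 2 = (t ^ 2 - 1) * w 2 := by simp [T]
    have hT3 : T 3 = (t ^ 2 - 1) * w 3 := by simp [T]
    have hTT : Minkowski.bilin T T = -((2 * t * ρ) ^ 2) := by
      rw [bilin_self, hT0, hT1, hT2, hT3]; linear_combination -(t ^ 2 - 1) ^ 2 * hρ
    have hTw : Minkowski.bilin T w = -((t ^ 2 + 1) * ρ * w 0) + (t ^ 2 - 1) * ρ ^ 2 := by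
      rw [bilin_eq, hT0, hT1, hT2, hT3]; linear_combination -(t ^ 2 - 1) * hρ
    have h' := h T (by rw [hT0]; positivity) (by rw [hTT]; nlinarith [sq_nonneg (2 * t * ρ)])
    rw [hTT, hTw, neg_neg, Real.sqrt_sq (by positivity)] at h'
    -- `h' : 2tρ m ≤ (t² + 1) ρ w⁰ − (t² − 1) ρ²`; divide by `ρ > 0` and use `ρ ≥ w⁰`, `t² ≥ 1`
    have h3 : 2 * t * m ≤ (t ^ 2 + 1) * w 0 - (t ^ 2 - 1) * ρ := by
      by_contra! hlt
      nlinarith [mul_lt_mul_of_pos_left hlt hρpos]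
    nlinarith [mul_le_mul_of_nonneg_left hρw (by nlinarith : (0 : ℝ) ≤ t ^ 2 - 1)]

/-- The curve lemma, positive time orientation: if `γ` has derivative `v s` on `[0, 1]` with
`(v s)⁰ > 0` and `−η(v s, v s) ≥ μ > 0`, then `−η(γ 1 − γ 0, γ 1 − γ 0) ≥ μ` (reverse Minkowski
inequality in support-function form). [folklore] -/
private theorem curve_bound_pos {γ v : ℝ → E4} {μ : ℝ} (hμ : 0 < μ)
    (hγ : ∀ s ∈ Icc (0 : ℝ) 1, HasDerivAt γ (v s) s)
    (hv0 : ∀ s ∈ Icc (0 : ℝ) 1, 0 < v s 0)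
    (hvμ : ∀ s ∈ Icc (0 : ℝ) 1, μ ≤ -Minkowski.bilin (v s) (v s)) :
    μ ≤ -Minkowski.bilin (γ 1 - γ 0) (γ 1 - γ 0) := by
  have h := sq_le_of_support (γ 1 - γ 0) (Real.sqrt_pos.2 hμ)
    (fun T hT0 hT ↦ support_bound hμ.le hγ hv0 hvμ T hT0 hT)
  rwa [Real.sq_sqrt hμ.le] at h

/-- The curve lemma without orientation hypothesis: if `γ` has derivative `v s` on `[0, 1]` with
`−η(v s, v s) ≥ μ > 0`, then `−η(γ 1 − γ 0, γ 1 − γ 0) ≥ μ`.  The time components `(v s)⁰ ≠ 0` are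
derivatives, so by DARBOUX they have constant sign on `[0, 1]`; the negative case is the positive
one for `−γ`. [folklore] -/
private theorem curve_bound {γ v : ℝ → E4} {μ : ℝ} (hμ : 0 < μ)
    (hγ : ∀ s ∈ Icc (0 : ℝ) 1, HasDerivAt γ (v s) s)
    (hvμ : ∀ s ∈ Icc (0 : ℝ) 1, μ ≤ -Minkowski.bilin (v s) (v s)) :
    μ ≤ -Minkowski.bilin (γ 1 - γ 0) (γ 1 - γ 0) := by
  have hd : ∀ s ∈ Icc (0 : ℝ) 1, HasDerivWithinAt (fun r ↦ γ r 0) (v s 0) (Icc 0 1) s :=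
    fun s hs ↦ ((EuclideanSpace.proj (𝕜 := ℝ) (0 : Fin 4)).hasFDerivAt.comp_hasDerivAt s
      (hγ s hs)).hasDerivWithinAt
  have hne : ∀ s ∈ Icc (0 : ℝ) 1, v s 0 ≠ 0 := by
    intro s hs h0
    have h1 := hvμ s hs
    rw [bilin_self, h0] at h1
    nlinarith [sq_nonneg (v s 1), sq_nonneg (v s 2), sq_nonneg (v s 3)]
  rcases hasDerivWithinAt_forall_lt_or_forall_gt_of_forall_ne (convex_Icc 0 1) hd hne with
    hneg | hpos
  · have h := curve_bound_pos (γ := fun s ↦ -γ s) (v := fun s ↦ -v s) hμ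
      (fun s hs ↦ (hγ s hs).fun_neg) (fun s hs ↦ by simpa using hneg s hs)
      (fun s hs ↦ by simpa only [bilin_neg_neg] using hvμ s hs)
    have h2 : -γ 1 - -γ 0 = -(γ 1 - γ 0) := by abel
    rwa [h2, bilin_neg_neg] at h
  · exact curve_bound_pos hμ hγ hpos hvμ

/-! ## The pointwise estimate -/

/-- Pointwise estimate: if `(η + η₂)(Lu, Lu) = (η + η₁)(u, u)` with `‖η₁‖, ‖η₂‖ ≤ ε`, `‖L‖ ≤ Γ` and
`η(u, u) ≤ −‖u‖²/4`, then `(1 − 4(1 + Γ²)ε)(−η(u, u)) ≤ −η(Lu, Lu)`. [folklore] -/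
private theorem pointwise {Γ ε : ℝ} {L : E4 →L[ℝ] E4} {η₁ η₂ : E4 →L[ℝ] E4 →L[ℝ] ℝ} {u : E4}
    (hΓ : 0 ≤ Γ) (hε : 0 ≤ ε) (hL : ‖L‖ ≤ Γ) (h₁ : ‖η₁‖ ≤ ε) (h₂ : ‖η₂‖ ≤ ε)
    (hiso : (Minkowski.bilin + η₂) (L u) (L u) = (Minkowski.bilin + η₁) u u)
    (hu : Minkowski.bilin u u ≤ -(1 / 4) * ‖u‖ ^ 2) :
    (1 - 4 * (1 + Γ ^ 2) * ε) * -Minkowski.bilin u u ≤ -Minkowski.bilin (L u) (L u) := by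
  simp only [add_apply] at hiso
  have hLu : ‖L u‖ ≤ Γ * ‖u‖ := L.le_of_opNorm_le hL u
  have e1 : |η₁ u u| ≤ ε * ‖u‖ * ‖u‖ := by
    have h := η₁.le_opNorm₂ u u
    rw [Real.norm_eq_abs] at h
    calc |η₁ u u| ≤ ‖η₁‖ * ‖u‖ * ‖u‖ := h
      _ ≤ ε * ‖u‖ * ‖u‖ := by gcongr
  have e2 : |η₂ (L u) (L u)| ≤ ε * (Γ * ‖u‖) * (Γ * ‖u‖) := by
    have h := η₂.le_opNorm₂ (L u) (L u)
    rw [Real.norm_eq_abs] at h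
    calc |η₂ (L u) (L u)| ≤ ‖η₂‖ * ‖L u‖ * ‖L u‖ := h
      _ ≤ ε * (Γ * ‖u‖) * (Γ * ‖u‖) := by gcongr
  have key : ε * (1 + Γ ^ 2) * ‖u‖ ^ 2 ≤ ε * (1 + Γ ^ 2) * (-4 * Minkowski.bilin u u) :=
    mul_le_mul_of_nonneg_left (by linarith) (by positivity)
  have := abs_le.1 e1
  have := abs_le.1 e2
  linarith

/-! ## The registered brick -/

/-- **Registered brick `stub_oneSidedIntervalComparison`** of line `Sketch` of the crux
`GapDecaySuffices`: the ONE-SIDED INTERVAL COMPARISON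
`AnchoredV2.OneSidedIntervalComparison` — for `Γ ≥ 1`, with `C = 4(1 + Γ²)` and
`ε₀ = 1/(2C)`, an exact isometry `k` (differentiable on an open convex `D ⊆ E4`, `‖Dk‖ ≤ Γ`) between
`η + h₁` and `η + h₂` with `‖h₁‖, ‖h₂ ∘ k‖ ≤ ε ≤ ε₀` maps uniformly timelike pairs `P, Q ∈ D` to pairs
with `(1 − Cε)(−η(Q − P, Q − P)) ≤ −η(kQ − kP, kQ − kP)` (pointwise estimate + Darboux + reverse
Cauchy–Schwarz / reverse Minkowski inequality along `s ↦ k(P + s(Q − P))`; O'Neill 1983, Ch. 5).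
[folklore] -/
theorem stub_oneSidedIntervalComparison :
    Theorems.GapDecaySuffices.Location.AnchoredV2.OneSidedIntervalComparison := by
  intro Γ hΓ
  refine ⟨4 * (1 + Γ ^ 2), 1 / (2 * (4 * (1 + Γ ^ 2))), by positivity, by positivity, ?_⟩
  intro ε D k h₁ h₂ hε hεε₀ hD hDo hk hkΓ hh₁ hh₂ hiso P hP Q hQ hPQ
  have hC0 : 0 < 4 * (1 + Γ ^ 2) := by positivity
  have hCε : 4 * (1 + Γ ^ 2) * ε ≤ 1 / 2 := by
    have h := mul_le_mul_of_nonneg_left hεε₀ hC0.le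
    rwa [show 4 * (1 + Γ ^ 2) * (1 / (2 * (4 * (1 + Γ ^ 2)))) = (1 / 2 : ℝ) by
      field_simp] at h
  -- the segment `[P, Q]` lies in `D`
  have hseg : ∀ s ∈ Icc (0 : ℝ) 1, P + s • (Q - P) ∈ D := fun s hs ↦ hD.add_smul_sub_mem hP hQ hs
  -- the degenerate pair
  rcases eq_or_ne (Q - P) 0 with hu0 | hu0
  · obtain rfl : Q = P := sub_eq_zero.1 hu0
    simp
  -- the comparison constant `μ > 0`
  have hupos : 0 < -Minkowski.bilin (Q - P) (Q - P) := by
    have h := norm_pos_iff.2 hu0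
    nlinarith
  have hμ0 : 0 < (1 - 4 * (1 + Γ ^ 2) * ε) * -Minkowski.bilin (Q - P) (Q - P) :=
    mul_pos (by linarith) hupos
  -- the curve `s ↦ k (P + s (Q − P))` and its velocities
  have hγd : ∀ s ∈ Icc (0 : ℝ) 1,
      HasDerivAt (fun r : ℝ ↦ k (P + r • (Q - P))) (fderiv ℝ k (P + s • (Q - P)) (Q - P)) s := by
    intro s hs
    have hx := hseg s hs
    have hk' : HasFDerivAt k (fderiv ℝ k (P + s • (Q - P))) (P + s • (Q - P)) :=
      ((hk _ hx).differentiableAt (hDo.mem_nhds hx)).hasFDerivAt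
    have hl : HasDerivAt (fun r : ℝ ↦ P + r • (Q - P)) (Q - P) s := by
      simpa using ((hasDerivAt_id s).smul_const (Q - P)).const_add P
    exact hk'.comp_hasDerivAt s hl
  have hvμ : ∀ s ∈ Icc (0 : ℝ) 1, (1 - 4 * (1 + Γ ^ 2) * ε) * -Minkowski.bilin (Q - P) (Q - P) ≤
      -Minkowski.bilin (fderiv ℝ k (P + s • (Q - P)) (Q - P))
        (fderiv ℝ k (P + s • (Q - P)) (Q - P)) := fun s hs ↦
    pointwise (by linarith) hε (hkΓ _ (hseg s hs)) (hh₁ _ (hseg s hs)) (hh₂ _ (hseg s hs))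
      (hiso _ (hseg s hs) (Q - P) (Q - P)) hPQ
  have key := curve_bound hμ0 hγd hvμ
  simpa using key

end Summit.FinalStateConjecture.FinalStateConjecture.Theorems.GapDecaySuffices.Location.IntervalComparison

end
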